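/-
Copyright (c) 2026 the pub-hodgecm-mathlib formalisation cell (harness21).  Prover seat hodgecm-mathlib-LH4-p17 (g0), req620 Track A «(D-RAM) FOUR-FRAME» squad, helper lane on
h413 = stmt-HodgeConjecture-24833 (count-neutral).  β-BOARD v1 (sub-dealer LH4-p05 (g8)) row R3 «G₁ ε-BOUNDARY TOWER FILE», FILE 3: the CHARACTER of the value-class label on the
glued representative `latt V(1,1,g)` beyond the one-slot cell, and its slot indicators `[ω_i·λ ≡ 1 on S_F]` for `i = 0, 1`.  2026-09-04.
-/
import Summits.HodgeConjecture.HodgeConjecture.Theorems.F0P3cDyRamDiagonalKappaGluedClass      -- ★ κG-A2 (LH4-p09 (g3)): `mem_fixedUnitStabilizer_glued_rep_iff`; brings ★ κG-A1, ★ the ω-conductor toolkit, ★ `…NonNormUnit`, ★ TorusDefs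
import Summits.HodgeConjecture.HodgeConjecture.Theorems.F0P3cDyRamDiagonalKappaSplitCountEval  -- ★ (LH4-p04): `normSign_mul_self`
import HarnessLib

/-!
# Crux `H413`, line LH4 «(D-RAM) FOUR-FRAME» — (β) Stage B, R3 FILE 3 «THE LABEL CHARACTER OF THE GLUED REPRESENTATIVE BEYOND THE ONE-SLOT CELL»

Cell `hodgecm-mathlib` (D-0151), FLOOR 0, crux item H413 = `stmt-HodgeConjecture-24833`, route `HCCMUnconditional`; squad F0∕P3c∕LH4.  THEOREMS ONLY (no `def`, no instance, no
notation, no `sorry`, default heartbeats); ★-only imports; lane `--supports stmt-HodgeConjecture-24833 --as helper` (count-neutral); pays NO row, states NO law.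

THE MATHEMATICS (β-BOARD v1 R3; [Kottwitz1986BaseChangeUnits, §1], [LanglandsShelstad1987, §3], [Serre1979, V §3 ∕ XV §2]).  On the glued representative `latt V(1,1,g)`
(`|g| = |ϖ|^{2t}`, `ρ ≥ 1`) the fixed unit stabiliser is `S_F = {u : |u₂ − u₁| ≤ |ϖ|^{ρ+2t}, |g⁻¹(u₂−u₁) + (u₂−u₀)| ≤ |ϖ|^{2ρ}}` (★ `mem_fixedUnitStabilizer_glued_rep_iff`), so
`u₀∕u₁ ∈ U^{[ρ]}` and `u₂∕u₁ ∈ U^{[ρ+2t]}` on `S_F` (§1).  The value-class label of the class `D(g)·u` is `ω(u₀·g·g_α + u₁·g_β)` (★ p13 `valueClassLabel_glued_rep_class_iff_normSign`),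
and EXACTLY `u₀·g·g_α + u₁·g_β = g_β(1+rg)·u₁·(1 + c·(u₀∕u₁ − 1))` with `r = g_α∕g_β`, `c = rg∕(1+rg)` (§3 `normSign_twoSlot_factor`): the label is `ε·λ_c(u)` with the SIGN
`ε = ω(g_β(1+rg))` of the orbit and the CHARACTER `λ_c(u) = ω(u₁)·ω(1 + c·(u₀∕u₁ − 1))`, which is `{±1}`-valued and MULTIPLICATIVE on `S_F` as soon as `|c|·|ϖ|^{2ρ} ≤ |ϖ|^{2d−1}`
(§2: the defect of additivity `c(1−c)(v−1)(v′−1)` is below the conductor) — the hypothesis shape of ★ p861456 `labelledOddCount_div_relIndex_eq_of_character`.  §4 evaluates that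
head's indicators for the slots `0` and `1`: `[ω₀·λ_c ≡ 1 on S_F] = [2d ≤ ρ + 1]` and, for `|c| = |ϖ|^k` exactly, `[ω₁·λ_c ≡ 1 on S_F] = [2d ≤ ρ + k + 1]` — deep fixed one-units are
norms (★ `normSign_eq_one_of_fixed_of_v_sub_one_le`), and conversely the non-norm `n₀ ≡ 1 (ϖ^{2d−2})` of ★ `exists_fixed_unit_not_norm_v_sub_one_le` sits in `S_F` as
`u = (1+e, 1, 1 + e·g∕(1+g))` with `e = n₀ − 1` resp. `e = (n₀ − 1)∕c` (the corner congruence holding EXACTLY).  Slot `2` (which sees `r` and `n₃`) is the sequel file.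
HONEST LABEL.  Count-neutral; proves no census ((β-BAL)∕(β)∕T₊ OPEN); `HC_CM` is proved only modulo the 7 printed citations (2 remaining named inputs: hLiu418 =
`stmt-HodgeConjecture-24832`, h413 = `stmt-HodgeConjecture-24833`) until rung 0 closes.
-/

set_option autoImplicit false

noncomputable section

namespace Summit.HodgeConjecture.HodgeConjecture.Cruxes.H413.F0P3cDyRamLabelledOddGluedCharacter

open Matrix WithZero
open Literature.NumberTheory.Automorphic Literature.NumberTheory.Automorphic.HermitianLattice Literature.NumberTheory.Automorphic.UnitaryGroup
open Literature.NumberTheory.Automorphic.UnitaryLatticeTree Literature.NumberTheory.Automorphic.UnitaryThreeFourFrame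
open Literature.NumberTheory.LocalFields.WildQuadraticDatum
open Summit.HodgeConjecture.HodgeConjecture.Cruxes.H413.F0P3cDyRamDiagonalTorusDefs
open Summit.HodgeConjecture.HodgeConjecture.Cruxes.H413.F0P3cDyRamDiagonalKappaGluedClass (mem_fixedUnitStabilizer_glued_rep_iff)
open Summit.HodgeConjecture.HodgeConjecture.Cruxes.H413.F0P3cDyRamFixedCountDiagonalModel (normSign_mul_norm)
open Summit.HodgeConjecture.HodgeConjecture.Cruxes.H413.F0P3cDyRamStableSumSignClasses (normSign_eq_one_or)
open Summit.HodgeConjecture.HodgeConjecture.Cruxes.H413.F0P3cDyRamDiagonalKappaSplitCountEval (normSign_mul_self)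
open scoped Valued WithZero Matrix MatrixGroups

variable {K : Type} [Field K] [Valued K ℤᵐ⁰]

/-! ## §1  The shape of `S_F(latt V(1,1,g))`: `u₀∕u₁ ∈ U^{[ρ]}`, `u₂∕u₁ ∈ U^{[ρ+2t]}`, and the corner congruence -/

/-- **ON `S_F(latt V(1,1,g))`: `|u₀∕u₁ − 1| ≤ |ϖ|^ρ`, `|u₂∕u₁ − 1| ≤ |ϖ|^{ρ+2t}`, and `|(u₀∕u₁ − 1) − (u₂∕u₁ − 1)(1+g)∕g| ≤ |ϖ|^{2ρ}`** (★ `mem_fixedUnitStabilizer_glued_rep_iff`: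
`|u₂ − u₁| ≤ |ϖ|^{ρ+2t}` and the corner `|g⁻¹(u₂ − u₁) + (u₂ − u₀)| ≤ |ϖ|^{2ρ}`, divided by the unit `u₁`). [cite: Kottwitz1986BaseChangeUnits, §1 pp. 240–241] -/
theorem ratios_of_mem_fixedUnitStabilizer_glued_rep {σ : K →+* K} {ϖ : K} (hϖ0 : ϖ ≠ 0) (hϖ1 : Valued.v ϖ < 1) {ρ t : ℕ} (ht : 1 ≤ t) {g : K}
    (hg : Valued.v g = Valued.v ϖ ^ (2 * t)) (V : GL (Fin 3) K)
    (hV : (V : Matrix (Fin 3) (Fin 3) K) = !![1, 0, 0; 1, ϖ ^ ρ, 0; 1 * 1 + g, ϖ ^ ρ * 1, ϖ ^ (2 * ρ + 2 * t)])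
    {u : Fin 3 → Kˣ} (hu : u ∈ fixedUnitStabilizer σ (latt (V : Matrix (Fin 3) (Fin 3) K))) :
    Valued.v ((u 0 : K) / u 1 - 1) ≤ Valued.v ϖ ^ ρ ∧ Valued.v ((u 2 : K) / u 1 - 1) ≤ Valued.v ϖ ^ (ρ + 2 * t) ∧
      Valued.v (((u 0 : K) / u 1 - 1) - ((u 2 : K) / u 1 - 1) * (1 + g) / g) ≤ Valued.v ϖ ^ (2 * ρ) := by
  have hvϖ : 0 < Valued.v ϖ := (Valuation.pos_iff _).2 hϖ0
  obtain ⟨-, hu1, hu2⟩ := (mem_fixedUnitStabilizer_iff σ _ u).1 hu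
  have huT : u ∈ fixedUnitTorus σ 3 := (mem_fixedUnitTorus_iff σ u).2 ⟨hu1, hu2⟩
  obtain ⟨hb, hc⟩ := (mem_fixedUnitStabilizer_glued_rep_iff hϖ0 hϖ1.le ρ t hg V hV huT).1 hu
  have h0 : ∀ j, ((u j : Kˣ) : K) ≠ 0 := fun j => (u j).ne_zero
  have hg0 : g ≠ 0 := fun h => by rw [h, map_zero] at hg; exact (pow_ne_zero _ hvϖ.ne') hg.symm
  -- `u₂∕u₁`
  have hy : Valued.v ((u 2 : K) / u 1 - 1) ≤ Valued.v ϖ ^ (ρ + 2 * t) := by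
    rw [div_sub_one (h0 1), map_div₀, hu1 1, div_one]; exact hb
  -- the corner, divided by `u₁`
  have hcorner : Valued.v (((u 0 : K) / u 1 - 1) - ((u 2 : K) / u 1 - 1) * (1 + g) / g) ≤ Valued.v ϖ ^ (2 * ρ) := by
    have e : ((u 0 : K) / u 1 - 1) - ((u 2 : K) / u 1 - 1) * (1 + g) / g = -((g⁻¹ * ((u 2 : K) - u 1) + ((u 2 : K) - u 0)) / u 1) := by
      field_simp; ring
    rw [e, Valuation.map_neg, map_div₀, hu1 1, div_one]; exact hc
  refine ⟨?_, hy, hcorner⟩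
  -- `u₀∕u₁ − 1 = corner + (u₂∕u₁ − 1)(1+g)∕g`
  have hsplit : (u 0 : K) / u 1 - 1 = (((u 0 : K) / u 1 - 1) - ((u 2 : K) / u 1 - 1) * (1 + g) / g) + ((u 2 : K) / u 1 - 1) * (1 + g) / g := by ring
  have h1g : Valued.v (1 + g) = 1 := Valued.v.map_one_add_of_lt (by rw [hg]; exact pow_lt_one₀ zero_le hϖ1 (by omega))
  · rw [hsplit]
    refine (Valuation.map_add _ _ _).trans (max_le (hcorner.trans ?_) ?_)
    · rw [two_mul, pow_add]; exact mul_le_of_le_one_right zero_le (pow_le_one₀ zero_le hϖ1.le)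
    · rw [map_div₀, map_mul, h1g, mul_one, hg, div_le_iff₀ (pow_pos hvϖ _), ← pow_add]
      exact hy


/-- **THE KILLER CARRIER**: for a fixed `e` with `|e| ≤ |ϖ|^ρ` (`ρ, t ≥ 1`), `u = (1 + e, 1, 1 + e·g∕(1+g))` is a fixed unit diagonal in `S_F(latt V(1,1,g))` — `|u₂ − u₁| = |e||g| ≤ |ϖ|^{ρ+2t}`
and the corner `g⁻¹(u₂ − u₁) + (u₂ − u₀)` VANISHES — with `u₀∕u₁ − 1 = e`. [cite: Kottwitz1986BaseChangeUnits, §1 pp. 240–241] -/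
theorem exists_mem_fixedUnitStabilizer_glued_rep_of_ratio {σ : K →+* K} {ϖ : K} (hϖ0 : ϖ ≠ 0) (hϖ1 : Valued.v ϖ < 1) {ρ t : ℕ} (hρ : 1 ≤ ρ) (ht : 1 ≤ t)
    {g : K} (hσg : σ g = g) (hg : Valued.v g = Valued.v ϖ ^ (2 * t)) (V : GL (Fin 3) K)
    (hV : (V : Matrix (Fin 3) (Fin 3) K) = !![1, 0, 0; 1, ϖ ^ ρ, 0; 1 * 1 + g, ϖ ^ ρ * 1, ϖ ^ (2 * ρ + 2 * t)])
    {e : K} (hσe : σ e = e) (he : Valued.v e ≤ Valued.v ϖ ^ ρ) :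
    ∃ u ∈ fixedUnitStabilizer σ (latt (V : Matrix (Fin 3) (Fin 3) K)), ((u 0 : Kˣ) : K) = 1 + e ∧ ((u 1 : Kˣ) : K) = 1 ∧ ((u 2 : Kˣ) : K) = 1 + e * g / (1 + g) := by
  have hvϖ : 0 < Valued.v ϖ := (Valuation.pos_iff _).2 hϖ0
  have hρlt : Valued.v ϖ ^ ρ < 1 := pow_lt_one₀ zero_le hϖ1 (by omega)
  have hglt : Valued.v g < 1 := by rw [hg]; exact pow_lt_one₀ zero_le hϖ1 (by omega)
  have h1g : Valued.v (1 + g) = 1 := Valued.v.map_one_add_of_lt hglt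
  have h1g0 : (1 : K) + g ≠ 0 := fun h => by rw [h, map_zero] at h1g; exact zero_ne_one h1g
  have helt : Valued.v e < 1 := he.trans_lt hρlt
  have hu0v : Valued.v (1 + e) = 1 := Valued.v.map_one_add_of_lt helt
  have hu00 : (1 : K) + e ≠ 0 := fun h => by rw [h, map_zero] at hu0v; exact zero_ne_one hu0v
  have hw : Valued.v (e * g / (1 + g)) ≤ Valued.v ϖ ^ (ρ + 2 * t) := by
    rw [map_div₀, h1g, div_one, map_mul, hg, pow_add]; exact mul_le_mul_left he _
  have hwlt : Valued.v (e * g / (1 + g)) < 1 := hw.trans_lt (pow_lt_one₀ zero_le hϖ1 (by omega))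
  have hu2v : Valued.v (1 + e * g / (1 + g)) = 1 := Valued.v.map_one_add_of_lt hwlt
  have hu20 : (1 : K) + e * g / (1 + g) ≠ 0 := fun h => by rw [h, map_zero] at hu2v; exact zero_ne_one hu2v
  let u : Fin 3 → Kˣ := ![Units.mk0 (1 + e) hu00, 1, Units.mk0 (1 + e * g / (1 + g)) hu20]
  have hu0 : ((u 0 : Kˣ) : K) = 1 + e := rfl
  have hu1 : ((u 1 : Kˣ) : K) = 1 := rfl
  have hu2 : ((u 2 : Kˣ) : K) = 1 + e * g / (1 + g) := rfl
  have huT : u ∈ fixedUnitTorus σ 3 := by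
    rw [mem_fixedUnitTorus_iff]
    refine ⟨fun i => ?_, fun i => ?_⟩
    · fin_cases i
      · exact hu0v
      · exact map_one _
      · exact hu2v
    · fin_cases i
      · show σ (1 + e) = 1 + e
        rw [map_add, map_one, hσe]
      · exact map_one σ
      · show σ (1 + e * g / (1 + g)) = 1 + e * g / (1 + g)
        rw [map_add, map_one, map_div₀, map_mul, map_add, map_one, hσe, hσg]
  refine ⟨u, (mem_fixedUnitStabilizer_glued_rep_iff hϖ0 hϖ1.le ρ t hg V hV huT).2 ⟨?_, ?_⟩, hu0, hu1, hu2⟩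
  · rw [hu2, hu1, add_sub_cancel_left]; exact hw
  · have hg0 : g ≠ 0 := fun h => by rw [h, map_zero] at hg; exact (pow_ne_zero _ hvϖ.ne') hg.symm
    rw [hu2, hu1, hu0, show g⁻¹ * (1 + e * g / (1 + g) - 1) + (1 + e * g / (1 + g) - (1 + e)) = 0 by field_simp; ring, map_zero]
    exact zero_le

/-! ## §2  The label character `λ_c(u) = ω(u₁)·ω(1 + c·(u₀∕u₁ − 1))` is multiplicative on `S_F` below the conductor -/

section Character

variable [CompleteSpace K] [Finite 𝓀[K]] {σ : K →+* K} {ϖ : K} {d t₂ : ℕ}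

/-- **MULTIPLICATIVITY OF THE LABEL CHARACTER ON `S_F(latt V(1,1,g))`**: for `c` fixed with `|c| ≤ |ϖ|^k`, `2d ≤ k + 2ρ + 1`, `ρ, t ≥ 1`, and `u, u′ ∈ S_F`:
`λ_c(u·u′) = λ_c(u)·λ_c(u′)`, `λ_c(u) := ω(u₁)·ω(1 + c·(u₀∕u₁ − 1))` — `u₀∕u₁, u′₀∕u′₁ ∈ U^{[ρ]}` (§1), and
`(1 + c(v−1))(1 + c(v′−1)) − (1 + c(vv′−1)) = −c(1−c)(v−1)(v′−1)` has valuation `≤ |ϖ|^{k+2ρ} ≤ |ϖ|^{2d−1}` (★ `normSign_eq_of_near`).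
[cite: Serre1979, Ch. XV §2] [cite: LanglandsShelstad1987, §3] -/
theorem gluedChar_mul (hD : IsRamifiedQuadraticDatum σ ϖ d t₂) {ρ t : ℕ} (hρ : 1 ≤ ρ) (ht : 1 ≤ t) {g : K} (hg : Valued.v g = Valued.v ϖ ^ (2 * t))
    (V : GL (Fin 3) K) (hV : (V : Matrix (Fin 3) (Fin 3) K) = !![1, 0, 0; 1, ϖ ^ ρ, 0; 1 * 1 + g, ϖ ^ ρ * 1, ϖ ^ (2 * ρ + 2 * t)])
    {c : K} (hσc : σ c = c) {k : ℕ} (hck : Valued.v c ≤ Valued.v ϖ ^ k) (hk : 2 * d ≤ k + 2 * ρ + 1)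
    {u u' : Fin 3 → Kˣ} (hu : u ∈ fixedUnitStabilizer σ (latt (V : Matrix (Fin 3) (Fin 3) K))) (hu' : u' ∈ fixedUnitStabilizer σ (latt (V : Matrix (Fin 3) (Fin 3) K))) :
    normSign σ (((u * u') 1 : Kˣ) : K) * normSign σ (1 + c * ((((u * u') 0 : Kˣ) : K) / (((u * u') 1 : Kˣ) : K) - 1)) =
      (normSign σ ((u 1 : Kˣ) : K) * normSign σ (1 + c * (((u 0 : Kˣ) : K) / ((u 1 : Kˣ) : K) - 1))) *
        (normSign σ ((u' 1 : Kˣ) : K) * normSign σ (1 + c * (((u' 0 : Kˣ) : K) / ((u' 1 : Kˣ) : K) - 1))) := by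
  obtain ⟨hσ, hvσ, hϖ, -, -, -, -⟩ := id hD
  have hϖ0 : ϖ ≠ 0 := (Valuation.ne_zero_iff Valued.v).1 (by rw [hϖ]; exact exp_ne_zero)
  have hϖ1 : Valued.v ϖ < 1 := by rw [hϖ, ← exp_zero, exp_lt_exp]; norm_num
  have hϖle : ∀ n : ℕ, Valued.v ϖ ^ n ≤ 1 := fun n => pow_le_one₀ zero_le hϖ1.le
  obtain ⟨-, hu1, hu2⟩ := (mem_fixedUnitStabilizer_iff σ _ u).1 hu
  obtain ⟨-, hu'1, hu'2⟩ := (mem_fixedUnitStabilizer_iff σ _ u').1 hu'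
  have h0 : ∀ j, ((u j : Kˣ) : K) ≠ 0 := fun j => (u j).ne_zero
  have h0' : ∀ j, ((u' j : Kˣ) : K) ≠ 0 := fun j => (u' j).ne_zero
  set v : K := ((u 0 : Kˣ) : K) / ((u 1 : Kˣ) : K) with hvdef
  set v' : K := ((u' 0 : Kˣ) : K) / ((u' 1 : Kˣ) : K) with hv'def
  have hσv : σ v = v := by rw [hvdef, map_div₀, hu2, hu2]
  have hσv' : σ v' = v' := by rw [hv'def, map_div₀, hu'2, hu'2]
  have hv := (ratios_of_mem_fixedUnitStabilizer_glued_rep (σ := σ) hϖ0 hϖ1 ht hg V hV hu).1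
  have hv' := (ratios_of_mem_fixedUnitStabilizer_glued_rep (σ := σ) hϖ0 hϖ1 ht hg V hV hu').1
  rw [← hvdef] at hv
  rw [← hv'def] at hv'
  -- the product coordinates
  have hp1 : (((u * u') 1 : Kˣ) : K) = ((u 1 : Kˣ) : K) * ((u' 1 : Kˣ) : K) := by rw [Pi.mul_apply, Units.val_mul]
  have hpv : (((u * u') 0 : Kˣ) : K) / (((u * u') 1 : Kˣ) : K) = v * v' := by
    rw [Pi.mul_apply, Pi.mul_apply, Units.val_mul, Units.val_mul, hvdef, hv'def]; field_simp
  rw [hpv, hp1, normSign_mul_of_fixed hD (hu2 1) (hu'2 1) (h0 1) (h0' 1)]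
  -- the three correction factors are fixed units
  have hc1 : Valued.v c ≤ 1 := hck.trans (hϖle k)
  have hunit : ∀ w : K, Valued.v (w - 1) ≤ Valued.v ϖ ^ ρ → Valued.v (1 + c * (w - 1)) = 1 := fun w hw =>
    Valued.v.map_one_add_of_lt (by
      rw [map_mul]
      calc Valued.v c * Valued.v (w - 1) ≤ 1 * Valued.v ϖ ^ ρ := mul_le_mul' hc1 hw
        _ < 1 := by rw [one_mul]; exact pow_lt_one₀ zero_le hϖ1 (by omega))
  have hσw : ∀ w : K, σ w = w → σ (1 + c * (w - 1)) = 1 + c * (w - 1) := fun w hw => by rw [map_add, map_one, map_mul, hσc, map_sub, map_one, hw]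
  have hne : ∀ w : K, Valued.v (w - 1) ≤ Valued.v ϖ ^ ρ → 1 + c * (w - 1) ≠ 0 := fun w hw h0 => by
    have h := hunit w hw; rw [h0, map_zero] at h; exact zero_ne_one h
  have hvv1 : Valued.v (v * v' - 1) ≤ Valued.v ϖ ^ ρ := by
    rw [show v * v' - 1 = (v - 1) * v' + (v' - 1) by ring]
    refine (Valuation.map_add _ _ _).trans (max_le ?_ hv')
    rw [map_mul]
    have hv'1 : Valued.v v' = 1 := by rw [hv'def, map_div₀, hu'1, hu'1, div_one]
    rw [hv'1, mul_one]; exact hv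
  -- `ω(1 + c(vv′−1)) = ω((1 + c(v−1))(1 + c(v′−1)))` by the conductor
  have hnear : Valued.v ((1 + c * (v - 1)) * (1 + c * (v' - 1)) - (1 + c * (v * v' - 1))) ≤ Valued.v ϖ ^ (k + 2 * ρ) := by
    rw [show (1 + c * (v - 1)) * (1 + c * (v' - 1)) - (1 + c * (v * v' - 1)) = -(c * (1 - c) * ((v - 1) * (v' - 1))) by ring, Valuation.map_neg,
      map_mul, map_mul, map_mul, pow_add, two_mul, pow_add]
    have h1c : Valued.v (1 - c) ≤ 1 := (Valuation.map_sub _ _ _).trans (max_le (le_of_eq (map_one _)) hc1)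
    calc Valued.v c * Valued.v (1 - c) * (Valued.v (v - 1) * Valued.v (v' - 1)) ≤ Valued.v ϖ ^ k * 1 * (Valued.v ϖ ^ ρ * Valued.v ϖ ^ ρ) :=
          mul_le_mul' (mul_le_mul' hck h1c) (mul_le_mul' hv hv')
      _ = Valued.v ϖ ^ k * (Valued.v ϖ ^ ρ * Valued.v ϖ ^ ρ) := by rw [mul_one]
  have key := normSign_eq_of_near hD (by rw [map_mul, hσw v hσv, hσw v' hσv']) (hσw (v * v') (by rw [map_mul, hσv, hσv']))
    (by rw [map_mul, hunit v hv, hunit v' hv', mul_one]) (n := k + 2 * ρ) (by omega) hnear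
  rw [key, normSign_mul_of_fixed hD (hσw v hσv) (hσw v' hσv') (hne v hv) (hne v' hv')]
  ring

/-! ## §3  The two-slot label factors as SIGN × CHARACTER -/

/-- **`ω(u₀·g·(r g_β) + u₁·g_β) = ω(g_β(1+rg)) · (ω(u₁)·ω(1 + c·(u₀∕u₁ − 1)))`, `c = rg∕(1+rg)`** — the EXACT identity
`u₀·g·r·g_β + u₁·g_β = g_β(1+rg)·u₁·(1 + c(u₀∕u₁ − 1))` and multiplicativity of `ω` on fixed non-zero elements (★ `normSign_mul_of_fixed`); `|rg| < 1`, `|c(u₀∕u₁ − 1)| < 1`.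
[cite: Rogawski1990, §4.9 Prop. 4.9.1 (b) p. 55] [cite: Serre1979, Ch. V §3 Cor. 3] -/
theorem normSign_twoSlot_factor (hD : IsRamifiedQuadraticDatum σ ϖ d t₂) {g r gβ : K} (hσg : σ g = g) (hσr : σ r = r) (hσgβ : σ gβ = gβ) (hgβ0 : gβ ≠ 0)
    (hrg : Valued.v (r * g) < 1) {u : Fin 3 → Kˣ} (hu : u ∈ fixedUnitTorus σ 3)
    (hv : Valued.v (r * g / (1 + r * g) * (((u 0 : Kˣ) : K) / ((u 1 : Kˣ) : K) - 1)) < 1) :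
    normSign σ (((u 0 : Kˣ) : K) * g * (r * gβ) + ((u 1 : Kˣ) : K) * gβ) =
      normSign σ (gβ * (1 + r * g)) * (normSign σ ((u 1 : Kˣ) : K) * normSign σ (1 + r * g / (1 + r * g) * (((u 0 : Kˣ) : K) / ((u 1 : Kˣ) : K) - 1))) := by
  obtain ⟨hu1, hu2⟩ := (mem_fixedUnitTorus_iff σ u).1 hu
  have h0 : ∀ j, ((u j : Kˣ) : K) ≠ 0 := fun j => (u j).ne_zero
  have h1rg : Valued.v (1 + r * g) = 1 := Valued.v.map_one_add_of_lt hrg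
  have h1rg0 : (1 : K) + r * g ≠ 0 := fun h => by rw [h, map_zero] at h1rg; exact zero_ne_one h1rg
  have hw : Valued.v (1 + r * g / (1 + r * g) * (((u 0 : Kˣ) : K) / ((u 1 : Kˣ) : K) - 1)) = 1 := Valued.v.map_one_add_of_lt hv
  have hw0 : (1 : K) + r * g / (1 + r * g) * (((u 0 : Kˣ) : K) / ((u 1 : Kˣ) : K) - 1) ≠ 0 := fun h => by rw [h, map_zero] at hw; exact zero_ne_one hw
  have e1 : (1 + r * g) * (1 + r * g / (1 + r * g) * (((u 0 : Kˣ) : K) / ((u 1 : Kˣ) : K) - 1)) = 1 + r * g * (((u 0 : Kˣ) : K) / ((u 1 : Kˣ) : K)) := by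
    rw [mul_add, mul_one, ← mul_assoc, mul_div_cancel₀ _ h1rg0]; ring
  have hv1 : ((u 1 : Kˣ) : K) * (((u 0 : Kˣ) : K) / ((u 1 : Kˣ) : K)) = ((u 0 : Kˣ) : K) := by field_simp
  have e : ((u 0 : Kˣ) : K) * g * (r * gβ) + ((u 1 : Kˣ) : K) * gβ =
      (gβ * (1 + r * g)) * (((u 1 : Kˣ) : K) * (1 + r * g / (1 + r * g) * (((u 0 : Kˣ) : K) / ((u 1 : Kˣ) : K) - 1))) := by
    rw [show (gβ * (1 + r * g)) * (((u 1 : Kˣ) : K) * (1 + r * g / (1 + r * g) * (((u 0 : Kˣ) : K) / ((u 1 : Kˣ) : K) - 1))) =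
        gβ * ((u 1 : Kˣ) : K) * ((1 + r * g) * (1 + r * g / (1 + r * g) * (((u 0 : Kˣ) : K) / ((u 1 : Kˣ) : K) - 1))) by ring, e1, mul_add, mul_one,
      show gβ * ((u 1 : Kˣ) : K) * (r * g * (((u 0 : Kˣ) : K) / ((u 1 : Kˣ) : K))) = g * (r * gβ) * (((u 1 : Kˣ) : K) * (((u 0 : Kˣ) : K) / ((u 1 : Kˣ) : K))) by ring,
      hv1]
    ring
  have hσA : σ (gβ * (1 + r * g)) = gβ * (1 + r * g) := by rw [map_mul, hσgβ, map_add, map_one, map_mul, hσr, hσg]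
  have hσw : σ (1 + r * g / (1 + r * g) * (((u 0 : Kˣ) : K) / ((u 1 : Kˣ) : K) - 1)) = 1 + r * g / (1 + r * g) * (((u 0 : Kˣ) : K) / ((u 1 : Kˣ) : K) - 1) := by
    rw [map_add, map_one, map_mul, map_div₀, map_mul, hσr, hσg, map_add, map_one, map_mul, hσr, hσg, map_sub, map_one, map_div₀, hu2, hu2]
  rw [e, normSign_mul_of_fixed hD hσA (by rw [map_mul, hu2, hσw]) (mul_ne_zero hgβ0 h1rg0) (mul_ne_zero (h0 1) hw0),
    normSign_mul_of_fixed hD (hu2 1) hσw (h0 1) hw0]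

/-! ## §4  The indicators `[ω_i·λ_c ≡ 1 on S_F]` for the slots `0` and `1` -/

/-- **SLOT `0` (the own slot): `[∀ u ∈ S_F, ω(u₀)·λ_c(u) = 1] ↔ 2d ≤ ρ + 1`** (`c` fixed, `|c| ≤ |ϖ|^k`, `k ≥ 1`; `|2| < 1` for the killer): `ω(u₀)ω(u₁) = ω(u₀∕u₁)` and
`u₀∕u₁ ∈ U^{[ρ]}` — for `2d − 1 ≤ ρ` both `ω(u₀∕u₁)` and `ω(1 + c(u₀∕u₁ − 1))` are `1`; for `ρ ≤ 2d − 2` the carrier of `e = n₀ − 1` (§1) has `ω(n₀)·ω(1 + c(n₀ − 1)) = −1`.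
[cite: Serre1979, Ch. V §3 Prop. 5, Cor. 3; Ch. XV §2] [cite: LanglandsShelstad1987, §3] -/
theorem forall_normSign_zero_mul_gluedChar_iff (hD : IsRamifiedQuadraticDatum σ ϖ d t₂) (h2 : Valued.v (2 : K) < 1) {ρ t : ℕ} (hρ : 1 ≤ ρ) (ht : 1 ≤ t)
    {g : K} (hσg : σ g = g) (hg : Valued.v g = Valued.v ϖ ^ (2 * t))
    (V : GL (Fin 3) K) (hV : (V : Matrix (Fin 3) (Fin 3) K) = !![1, 0, 0; 1, ϖ ^ ρ, 0; 1 * 1 + g, ϖ ^ ρ * 1, ϖ ^ (2 * ρ + 2 * t)])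
    {c : K} (hσc : σ c = c) {k : ℕ} (hk : 1 ≤ k) (hck : Valued.v c ≤ Valued.v ϖ ^ k) :
    (∀ u ∈ fixedUnitStabilizer σ (latt (V : Matrix (Fin 3) (Fin 3) K)),
        normSign σ ((u 0 : Kˣ) : K) * (normSign σ ((u 1 : Kˣ) : K) * normSign σ (1 + c * (((u 0 : Kˣ) : K) / ((u 1 : Kˣ) : K) - 1))) = 1) ↔
      2 * d ≤ ρ + 1 := by
  obtain ⟨hσ, hvσ, hϖ, -, -, -, -⟩ := id hD
  have hϖ0 : ϖ ≠ 0 := (Valuation.ne_zero_iff Valued.v).1 (by rw [hϖ]; exact exp_ne_zero)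
  have hϖ1 : Valued.v ϖ < 1 := by rw [hϖ, ← exp_zero, exp_lt_exp]; norm_num
  have hmono : ∀ {a b : ℕ}, a ≤ b → Valued.v ϖ ^ b ≤ Valued.v ϖ ^ a := fun h => pow_le_pow_right_of_le_one' hϖ1.le h
  -- `ω(u₀)·ω(u₁) = ω(u₀∕u₁)` on fixed units
  have hquot : ∀ u : Fin 3 → Kˣ, u ∈ fixedUnitTorus σ 3 →
      normSign σ ((u 0 : Kˣ) : K) * normSign σ ((u 1 : Kˣ) : K) = normSign σ (((u 0 : Kˣ) : K) / ((u 1 : Kˣ) : K)) := by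
    intro u hu
    obtain ⟨hu1, hu2⟩ := (mem_fixedUnitTorus_iff σ u).1 hu
    have h0 : ∀ j, ((u j : Kˣ) : K) ≠ 0 := fun j => (u j).ne_zero
    rw [← normSign_mul_of_fixed hD (hu2 0) (hu2 1) (h0 0) (h0 1),
      show ((u 0 : Kˣ) : K) * ((u 1 : Kˣ) : K) = ((u 0 : Kˣ) : K) / ((u 1 : Kˣ) : K) * (((u 1 : Kˣ) : K) * σ ((u 1 : Kˣ) : K)) by rw [hu2 1]; field_simp,
      normSign_mul_norm σ _ (h0 1)]
  constructor
  · -- a killer below the window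
    intro hall
    by_contra hlt
    push Not at hlt
    obtain ⟨n₀, hσn₀, hn₀1, hn₀d, hn₀n⟩ := exists_fixed_unit_not_norm_v_sub_one_le hD h2
    have hn₀d' : Valued.v (n₀ - 1) ≤ Valued.v ϖ ^ (2 * (d - 1)) := by
      rw [v_varpi_pow hϖ]; convert hn₀d using 2; push_cast; ring
    have he : Valued.v (n₀ - 1) ≤ Valued.v ϖ ^ ρ := hn₀d'.trans (hmono (by omega))
    obtain ⟨u, hu, hu0, hu1, -⟩ := exists_mem_fixedUnitStabilizer_glued_rep_of_ratio hϖ0 hϖ1 hρ ht hσg hg V hV (by rw [map_sub, map_one, hσn₀]) he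
    obtain ⟨-, huv, huσ⟩ := (mem_fixedUnitStabilizer_iff σ _ u).1 hu
    have huT : u ∈ fixedUnitTorus σ 3 := (mem_fixedUnitTorus_iff σ u).2 ⟨huv, huσ⟩
    have h := hall u hu
    rw [← mul_assoc, hquot u huT, hu0, hu1, div_one, add_sub_cancel_left] at h
    have hn₀0 : n₀ ≠ 0 := fun h0 => by rw [h0, map_zero] at hn₀1; exact zero_ne_one hn₀1
    have hωn₀ : normSign σ (1 + (n₀ - 1)) = -1 := by
      rw [add_sub_cancel]; exact normSign_of_not_isNorm σ hn₀n
    have hωc : normSign σ (1 + c * (n₀ - 1)) = 1 :=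
      normSign_eq_one_of_fixed_of_v_sub_one_le hD (by rw [map_add, map_one, map_mul, hσc, map_sub, map_one, hσn₀]) (n := k + 2 * (d - 1)) (by omega)
        (by rw [add_sub_cancel_left, map_mul, pow_add]; exact mul_le_mul' hck hn₀d')
    rw [hωn₀, hωc] at h
    norm_num at h
  · -- inside the window both factors are `1`
    intro hwin u hu
    obtain ⟨-, huv, huσ⟩ := (mem_fixedUnitStabilizer_iff σ _ u).1 hu
    have huT : u ∈ fixedUnitTorus σ 3 := (mem_fixedUnitTorus_iff σ u).2 ⟨huv, huσ⟩
    have hv := (ratios_of_mem_fixedUnitStabilizer_glued_rep (σ := σ) hϖ0 hϖ1 ht hg V hV hu).1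
    have hσv : σ (((u 0 : Kˣ) : K) / ((u 1 : Kˣ) : K)) = ((u 0 : Kˣ) : K) / ((u 1 : Kˣ) : K) := by rw [map_div₀, huσ, huσ]
    rw [← mul_assoc, hquot u huT, normSign_eq_one_of_fixed_of_v_sub_one_le hD hσv (n := ρ) (by omega) hv, one_mul]
    exact normSign_eq_one_of_fixed_of_v_sub_one_le hD (by rw [map_add, map_one, map_mul, hσc, map_sub, map_one, hσv]) (n := k + ρ) (by omega)
      (by rw [add_sub_cancel_left, map_mul, pow_add]; exact mul_le_mul' hck hv)

/-- **SLOT `1` (the read slot): `[∀ u ∈ S_F, ω(u₁)·λ_c(u) = 1] ↔ 2d ≤ ρ + k + 1`** for `c` fixed with `|c| = |ϖ|^k` EXACTLY (`k ≥ 1`; `|2| < 1` for the killer): `ω(u₁)² = 1` so the value is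
`ω(1 + c(u₀∕u₁ − 1))`, `u₀∕u₁ ∈ U^{[ρ]}` — `1` throughout iff `k + ρ ≥ 2d − 1`; below, the carrier of `e = (n₀ − 1)∕c` (`|e| ≤ |ϖ|^{2d−2−k} ≤ |ϖ|^ρ`) reads `ω(n₀) = −1`.
[cite: Serre1979, Ch. V §3 Prop. 5, Cor. 3; Ch. XV §2] [cite: LanglandsShelstad1987, §3] -/
theorem forall_normSign_one_mul_gluedChar_iff (hD : IsRamifiedQuadraticDatum σ ϖ d t₂) (h2 : Valued.v (2 : K) < 1) {ρ t : ℕ} (hρ : 1 ≤ ρ) (ht : 1 ≤ t)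
    {g : K} (hσg : σ g = g) (hg : Valued.v g = Valued.v ϖ ^ (2 * t))
    (V : GL (Fin 3) K) (hV : (V : Matrix (Fin 3) (Fin 3) K) = !![1, 0, 0; 1, ϖ ^ ρ, 0; 1 * 1 + g, ϖ ^ ρ * 1, ϖ ^ (2 * ρ + 2 * t)])
    {c : K} (hσc : σ c = c) {k : ℕ} (hk : 1 ≤ k) (hck : Valued.v c = Valued.v ϖ ^ k) :
    (∀ u ∈ fixedUnitStabilizer σ (latt (V : Matrix (Fin 3) (Fin 3) K)),
        normSign σ ((u 1 : Kˣ) : K) * (normSign σ ((u 1 : Kˣ) : K) * normSign σ (1 + c * (((u 0 : Kˣ) : K) / ((u 1 : Kˣ) : K) - 1))) = 1) ↔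
      2 * d ≤ ρ + k + 1 := by
  obtain ⟨hσ, hvσ, hϖ, -, -, -, -⟩ := id hD
  have hϖ0 : ϖ ≠ 0 := (Valuation.ne_zero_iff Valued.v).1 (by rw [hϖ]; exact exp_ne_zero)
  have hvϖ : 0 < Valued.v ϖ := (Valuation.pos_iff _).2 hϖ0
  have hϖ1 : Valued.v ϖ < 1 := by rw [hϖ, ← exp_zero, exp_lt_exp]; norm_num
  have hmono : ∀ {a b : ℕ}, a ≤ b → Valued.v ϖ ^ b ≤ Valued.v ϖ ^ a := fun h => pow_le_pow_right_of_le_one' hϖ1.le h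
  have hc0 : c ≠ 0 := fun h => by rw [h, map_zero] at hck; exact (pow_ne_zero _ hvϖ.ne') hck.symm
  constructor
  · intro hall
    by_contra hlt
    push Not at hlt
    obtain ⟨n₀, hσn₀, hn₀1, hn₀d, hn₀n⟩ := exists_fixed_unit_not_norm_v_sub_one_le hD h2
    have hn₀d' : Valued.v (n₀ - 1) ≤ Valued.v ϖ ^ (2 * (d - 1)) := by
      rw [v_varpi_pow hϖ]; convert hn₀d using 2; push_cast; ring
    -- `e = (n₀ − 1)∕c`, `|e| ≤ |ϖ|^{2d−2−k} ≤ |ϖ|^ρ`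
    have he : Valued.v ((n₀ - 1) / c) ≤ Valued.v ϖ ^ ρ := by
      rw [map_div₀, hck, div_le_iff₀ (pow_pos hvϖ _), ← pow_add]
      exact hn₀d'.trans (hmono (by omega))
    obtain ⟨u, hu, hu0, hu1, -⟩ := exists_mem_fixedUnitStabilizer_glued_rep_of_ratio hϖ0 hϖ1 hρ ht hσg hg V hV
      (by rw [map_div₀, map_sub, map_one, hσn₀, hσc]) he
    have h := hall u hu
    rw [← mul_assoc, normSign_mul_self σ _, one_mul, hu0, hu1, div_one, add_sub_cancel_left, mul_div_cancel₀ _ hc0, add_sub_cancel,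
      normSign_of_not_isNorm σ hn₀n] at h
    norm_num at h
  · intro hwin u hu
    obtain ⟨-, huv, huσ⟩ := (mem_fixedUnitStabilizer_iff σ _ u).1 hu
    have hv := (ratios_of_mem_fixedUnitStabilizer_glued_rep (σ := σ) hϖ0 hϖ1 ht hg V hV hu).1
    have hσv : σ (((u 0 : Kˣ) : K) / ((u 1 : Kˣ) : K)) = ((u 0 : Kˣ) : K) / ((u 1 : Kˣ) : K) := by rw [map_div₀, huσ, huσ]
    rw [← mul_assoc, normSign_mul_self σ _, one_mul]
    exact normSign_eq_one_of_fixed_of_v_sub_one_le hD (by rw [map_add, map_one, map_mul, hσc, map_sub, map_one, hσv]) (n := k + ρ) (by omega)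
      (by rw [add_sub_cancel_left, map_mul, hck, pow_add]; exact mul_le_mul_right hv _)

end Character

end Summit.HodgeConjecture.HodgeConjecture.Cruxes.H413.F0P3cDyRamLabelledOddGluedCharacter

end
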